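import Mathlib
import Literature.MathematicalPhysics.QuantumFieldTheory.Luscher2010.TrivializingMaps
import Literature.MathematicalPhysics.QuantumFieldTheory.Luscher2010.FlowActionSeries
import Summits.Ventures.LatticeQCDFlow.TrivializingMaps.Truncation
import Summits.Ventures.LatticeQCDFlow.TrivializingMaps.PoissonSolver
import Summits.Ventures.LatticeQCDFlow.TrivializingMaps.WilsonPolynomials
import HarnessLib

/-!
# Existence of a smooth Lüscher series for the Wilson action, with linear footprint growth

HONEST FRAMING: exact (Metropolis-corrected) sampling algorithms for lattice gauge theory; figures of merit are
autocorrelation/cost numbers at stated couplings and volumes; no continuum-physics claim.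

This file PROVES the typed venture target `LuscherFootprintLinear` (file `Truncation`, §4): on every finite
periodic lattice `(ℤ/Lℤ)^d`, `L ≥ 1`, for every `n` and every orthonormal basis `B` of `𝔰𝔲(n)`, the Wilson
plaquette action `S_W` (`ambWilsonAction`, Lüscher's normalisation) admits a family `(S̃^{(k)})_{k ≥ 0}` of
SMOOTH ambient field functionals solving Lüscher's recursion (CMP 293 (2010) 899, §4.3, eqs. (4.12)–(4.15))
`Δ S̃^{(0)} = S_W + Ċ^{(0)}`, `Δ S̃^{(k)} = -∑_{e,a} ∂^a_e S_W · ∂^a_e S̃^{(k-1)} + Ċ^{(k)}` on `SU(n)^E`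
(`IsLuscherSeries`), whose order-`k` term is a LOCAL SUM OF RANGE `1 + k` (`IsLocalSum`): `S̃^{(k)} = ∑_e G^{(k)}_e`
with `G^{(k)}_e` a loop polynomial of degree `≤ 4(k+1)` in the link variables of the plaquette ball
`linkBall (k+1) e` only.

Construction (Lüscher §4.4 made effective, "the procedure is then again purely algebraic"): write
`S_W = ∑_e s_e` with `s_e` the sum of the plaquettes `Re tr(1 - U_p)` whose FIRST link is `e` (file
`WilsonPolynomials`, `anchorS`); solve `Δ G^{(0)}_e = s_e - ⟨s_e⟩` inside the finite-dimensional `Δ`-stable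
space `PD 4 (linkBall 1 e)` of degree-`≤ 4` link polynomials supported in the radius-one plaquette ball of
`e` (file `PoissonSolver`, `exists_linkLap_eq_sub_mean` — rank–nullity plus the zero-mode theorem, no spectral
theory); then recursively solve `Δ G^{(k+1)}_e = -(∑_{e',a} ∂^a_{e'} S_W · ∂^a_{e'} G^{(k)}_e) + const` inside
`PD (4(k+2)) (linkBall (k+2) e)`: the right-hand side lives there because `∂^a_{e'}` kills `G^{(k)}_e` unless
`e' ∈ linkBall (k+1) e`, and `∂^a_{e'} S_W` only involves the plaquettes through `e'`
(`linkDeriv_ambWilsonAction_mem`), all of whose links lie in `linkBall (k+2) e`. Summing over the anchor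
`e` and using linearity of `∂`, `Δ` (`linkDeriv_finset_sum`, `linkLap_finset_sum`) gives the recursion
with the constants `Ċ^{(0)} = -∑_e ⟨s_e⟩`, `Ċ^{(k+1)} = ∑_e ⟨∑_{e',a} ∂S_W ∂G^{(k)}_e⟩` (`⟨·⟩` = mean for the
product Haar measure `D[U]`).

Main results: `isLuscherSeries_wilsonSk`, `isLocalSum_wilsonSk`, `luscherFootprintLinear_holds : LuscherFootprintLinear d L n`,
`exists_isLuscherSeries_wilson`. By `SeriesUniqueness` (`IsLuscherSeries.linkDeriv_eq`) every other smooth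
solution has the same link gradients order by order, so the flow generator `Z_t = -∂S̃_t` of ANY Lüscher
series of `S_W` inherits this locality.

References: M. Lüscher, Trivializing maps, the Wilson flow and the HMC algorithm, CMP 293 (2010) 899
[Luscher2010Trivializing, arXiv:0907.5491], §4.3 eqs. (4.12)–(4.15), §4.4 eqs. (4.16)–(4.22), §4.5(a).
-/

namespace Summit.Ventures.LatticeQCDFlow.TrivializingMaps

open MeasureTheory
open Literature.MathematicalPhysics.QuantumFieldTheory
open Literature.MathematicalPhysics.QuantumFieldTheory.Luscher2010
open scoped Matrix Matrix.Norms.Frobenius ContDiff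

noncomputable section

section Construction

variable {d L n : ℕ} [NeZero L]

/-- The spaces `PD m A` consist of smooth functionals. [folklore] -/
theorem PD_smooth (m : ℕ) (A : Set (Edge d L)) : ∀ f ∈ PD (n := n) m A, ContDiff ℝ ∞ f :=
  fun _ hf => contDiff_of_mem_PD hf

/-- The spaces `PD m A` are stable under the link Laplacian (Lüscher §4.4: "`Δ` maps any polynomial in
`W₀, W₁, …` into another polynomial in these variables"). [cite: Luscher2010Trivializing, §4.4] -/
theorem PD_lapStable (B : SuBasis n) (m : ℕ) (A : Set (Edge d L)) :
    ∀ f ∈ PD (n := n) m A, linkLap B f ∈ PD m A :=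
  fun _ hf => linkLap_mem_PD B hf

omit [NeZero L] in
/-- The spaces `PD m A` contain the constants. [folklore] -/
theorem PD_one (m : ℕ) (A : Set (Edge d L)) : (fun _ => (1 : ℝ)) ∈ PD (n := n) m A :=
  const_mem_PD m A 1

/-- **The Poisson solver in `PD m A`**: for `g ∈ PD m A`, a chosen `f ∈ PD m A` with `Δf = g - ⟨g⟩` on
`SU(n)^E` (`PoissonSolver.exists_linkLap_eq_sub_mean`). [cite: Luscher2010Trivializing, §4.3–§4.4] -/
def solvePD (B : SuBasis n) {m : ℕ} {A : Set (Edge d L)} {g : AmbConfig d L n → ℝ}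
    (hg : g ∈ PD (n := n) m A) : AmbConfig d L n → ℝ :=
  Classical.choose (exists_linkLap_eq_sub_mean (PD_smooth m A) (PD_lapStable B m A) (PD_one m A) hg)

/-- The defining property of `solvePD`: membership, normalisation at `1`, and the Poisson equation on `SU(n)^E`. [folklore] -/
theorem solvePD_spec (B : SuBasis n) {m : ℕ} {A : Set (Edge d L)} {g : AmbConfig d L n → ℝ}
    (hg : g ∈ PD (n := n) m A) :
    solvePD B hg ∈ PD m A ∧ solvePD B hg (WilsonFlow.coeConfig fun _ => 1) = 0 ∧
      ∀ U : GaugeConfig d L (Matrix.specialUnitaryGroup (Fin n) ℂ),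
        linkLap B (solvePD B hg) (WilsonFlow.coeConfig U) = g (WilsonFlow.coeConfig U) -
          ∫ U', g (WilsonFlow.coeConfig U') ∂(trivialMeasure (Matrix.specialUnitaryGroup (Fin n) ℂ) d L) :=
  Classical.choose_spec (exists_linkLap_eq_sub_mean (PD_smooth m A) (PD_lapStable B m A) (PD_one m A) hg)

/-- `solvePD` stays in the space `PD m A` of its right-hand side. [folklore] -/
theorem solvePD_mem (B : SuBasis n) {m : ℕ} {A : Set (Edge d L)} {g : AmbConfig d L n → ℝ}
    (hg : g ∈ PD (n := n) m A) : solvePD B hg ∈ PD m A :=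
  (solvePD_spec B hg).1

/-- `solvePD` solves `Δ f = g - ⟨g⟩` on `SU(n)^E`. [folklore] -/
theorem linkLap_solvePD (B : SuBasis n) {m : ℕ} {A : Set (Edge d L)} {g : AmbConfig d L n → ℝ}
    (hg : g ∈ PD (n := n) m A) (U : GaugeConfig d L (Matrix.specialUnitaryGroup (Fin n) ℂ)) :
    linkLap B (solvePD B hg) (WilsonFlow.coeConfig U) = g (WilsonFlow.coeConfig U) -
      ∫ U', g (WilsonFlow.coeConfig U') ∂(trivialMeasure (Matrix.specialUnitaryGroup (Fin n) ℂ) d L) :=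
  (solvePD_spec B hg).2.2 U

/-- Lüscher's bilinear right-hand side `∑_{e',a} ∂^a_{e'} S_W · ∂^a_{e'} f` of (4.13)/(4.15) (minus sign
apart), for the Wilson action. [cite: Luscher2010Trivializing, §4.3 eq. (4.15)] -/
def wilsonRhs (B : SuBasis n) (f : AmbConfig d L n → ℝ) : AmbConfig d L n → ℝ := fun W =>
  ∑ e' : Edge d L, ∑ a : B.ι,
    linkDeriv e' (B.T a) (ambWilsonAction : AmbConfig d L n → ℝ) W * linkDeriv e' (B.T a) f W

/-- **Footprint and degree growth of the recursion step**: if `f` is a link polynomial of degree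
`≤ 4(k+1)` in the links of `linkBall (k+1) e`, then `∑_{e',a} ∂^a_{e'} S_W · ∂^a_{e'} f` is a link polynomial
of degree `≤ 4(k+2)` in the links of `linkBall (k+2) e` — `∂_{e'} f = 0` unless `e' ∈ linkBall (k+1) e`, and
`∂_{e'} S_W` involves only the plaquettes through `e'`. [cite: Luscher2010Trivializing, §4.4–§4.5(a)] -/
theorem wilsonRhs_mem (B : SuBasis n) {k : ℕ} {e : Edge d L} {f : AmbConfig d L n → ℝ}
    (hf : f ∈ PD (n := n) (4 * (k + 1)) (linkBall (k + 1) e)) :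
    wilsonRhs B f ∈ PD (n := n) (4 * (k + 1 + 1)) (linkBall (k + 1 + 1) e) := by
  have hfun : wilsonRhs B f = ∑ e' : Edge d L, ∑ a : B.ι,
      linkDeriv e' (B.T a) (ambWilsonAction : AmbConfig d L n → ℝ) * linkDeriv e' (B.T a) f := by
    funext W
    simp only [wilsonRhs, Finset.sum_apply, Pi.mul_apply]
  rw [hfun]
  refine Submodule.sum_mem _ fun e' _ => Submodule.sum_mem _ fun a _ => ?_
  by_cases he' : e' ∈ linkBall (k + 1) e
  · exact mul_mem_PD (by omega)
      (PD_mono le_rfl (plaqNbhd_subset_linkBall_succ (k + 1) he')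
        (linkDeriv_ambWilsonAction_mem e' (B.T a)))
      (PD_mono le_rfl (linkBall_subset_succ (k + 1) e) (linkDeriv_mem_PD e' (B.T a) hf))
  · have h0 : linkDeriv e' (B.T a) f = 0 := linkDeriv_eq_zero_of_not_mem (B.T a) hf.2 he'
    rw [h0, mul_zero]
    exact Submodule.zero_mem _

omit [NeZero L] in
/-- The anchored plaquette sum `s_e` lies in `PD (4·(0+1)) (linkBall (0+1) e)` (index bookkeeping for the
recursion). [folklore] -/
theorem anchorS_mem' (e : Edge d L) :
    anchorS (n := n) e ∈ PD (n := n) (4 * (0 + 1)) (linkBall (0 + 1) e) :=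
  anchorS_mem e

/-- **The anchored Lüscher recursion** `G^{(k)}_e`: `G^{(0)}_e` solves `Δ G = s_e - ⟨s_e⟩` in
`PD 4 (linkBall 1 e)`, and `G^{(k+1)}_e` solves `Δ G = -(∑ ∂S_W ∂G^{(k)}_e) + ⟨∑ ∂S_W ∂G^{(k)}_e⟩` in
`PD (4(k+2)) (linkBall (k+2) e)`. [cite: Luscher2010Trivializing, §4.3 eqs. (4.14)–(4.15), §4.4] -/
def anchRec (B : SuBasis n) : (k : ℕ) → (e : Edge d L) →
    {f : AmbConfig d L n → ℝ // f ∈ PD (n := n) (4 * (k + 1)) (linkBall (k + 1) e)}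
  | 0, e => ⟨solvePD B (anchorS_mem' e), solvePD_mem B (anchorS_mem' e)⟩
  | k + 1, e =>
      ⟨solvePD B (neg_mem (wilsonRhs_mem B (anchRec B k e).2)),
        solvePD_mem B (neg_mem (wilsonRhs_mem B (anchRec B k e).2))⟩

/-- The order-`k`, anchor-`e` term `G^{(k)}_e` as a field functional. [folklore] -/
def anchTerm (B : SuBasis n) (k : ℕ) (e : Edge d L) : AmbConfig d L n → ℝ := (anchRec B k e).1

/-- `G^{(k)}_e ∈ PD (4(k+1)) (linkBall (k+1) e)`. [folklore] -/
theorem anchTerm_mem (B : SuBasis n) (k : ℕ) (e : Edge d L) :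
    anchTerm B k e ∈ PD (n := n) (4 * (k + 1)) (linkBall (k + 1) e) :=
  (anchRec B k e).2

/-- Unfolding the base case of the anchored recursion. [folklore] -/
theorem anchTerm_zero (B : SuBasis n) (e : Edge d L) :
    anchTerm B 0 e = solvePD B (anchorS_mem' (n := n) e) := rfl

/-- Unfolding the successor case of the anchored recursion. [folklore] -/
theorem anchTerm_succ (B : SuBasis n) (k : ℕ) (e : Edge d L) :
    anchTerm B (k + 1) e = solvePD B (neg_mem (wilsonRhs_mem B (anchTerm_mem B k e))) := rfl

/-- Every anchored term is smooth. [folklore] -/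
theorem contDiff_anchTerm (B : SuBasis n) (k : ℕ) (e : Edge d L) : ContDiff ℝ ∞ (anchTerm B k e) :=
  contDiff_of_mem_PD (anchTerm_mem B k e)

/-- `G^{(k)}_e` depends only on the links of the plaquette ball `linkBall (k+1) e`. [folklore] -/
theorem dependsOn_anchTerm (B : SuBasis n) (k : ℕ) (e : Edge d L) :
    DependsOn (anchTerm B k e) (linkBall (k + 1) e) :=
  (anchTerm_mem B k e).2

/-- Degree bound: every anchored term `G^{(k)}_e` is a link polynomial of degree `≤ 4(k+1)`.
[cite: Luscher2010Trivializing, §4.4] -/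
theorem anchTerm_mem_polyL (B : SuBasis n) (k : ℕ) (e : Edge d L) :
    anchTerm B k e ∈ polyL d L n (4 * (k + 1)) :=
  (anchTerm_mem B k e).1

end Construction

section Series

variable (d L : ℕ) {n : ℕ} [NeZero L]

/-- **The order-`k` flow action** `S̃^{(k)} = ∑_e G^{(k)}_e`. [cite: Luscher2010Trivializing, §4.3] -/
def wilsonSk (B : SuBasis n) (k : ℕ) : AmbConfig d L n → ℝ := fun W => ∑ e : Edge d L, anchTerm B k e W

/-- **The constants `Ċ^{(k)}`** of the recursion: `Ċ^{(0)} = -∑_e ⟨s_e⟩ = -⟨S_W⟩`,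
`Ċ^{(k+1)} = ∑_e ⟨∑_{e',a} ∂S_W ∂G^{(k)}_e⟩ = ⟨∑_{e',a} ∂S_W ∂S̃^{(k)}⟩`, means for `D[U]`.
[cite: Luscher2010Trivializing, §4.3 eqs. (4.14)–(4.15)] -/
def wilsonConst (B : SuBasis n) : ℕ → ℝ
  | 0 => -∑ e : Edge d L, ∫ U, anchorS (n := n) e (WilsonFlow.coeConfig U)
      ∂(trivialMeasure (Matrix.specialUnitaryGroup (Fin n) ℂ) d L)
  | k + 1 => ∑ e : Edge d L, ∫ U, wilsonRhs B (anchTerm B k e) (WilsonFlow.coeConfig U)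
      ∂(trivialMeasure (Matrix.specialUnitaryGroup (Fin n) ℂ) d L)

variable {d L}

/-- Every order of the constructed flow action is smooth. [folklore] -/
theorem contDiff_wilsonSk (B : SuBasis n) (k : ℕ) : ContDiff ℝ ∞ (wilsonSk d L B k) := by
  show ContDiff ℝ ∞ fun W => ∑ e : Edge d L, anchTerm B k e W
  exact ContDiff.sum fun e _ => contDiff_anchTerm B k e

/-- Order zero of the recursion: `Δ S̃^{(0)} = S_W + Ċ^{(0)}` on `SU(n)^E`.
[cite: Luscher2010Trivializing, §4.3 eqs. (4.12), (4.14)] -/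
theorem linkLap_wilsonSk_zero (B : SuBasis n) (U : GaugeConfig d L (Matrix.specialUnitaryGroup (Fin n) ℂ)) :
    linkLap B (wilsonSk d L B 0) (WilsonFlow.coeConfig U) =
      ambWilsonAction (WilsonFlow.coeConfig U) + wilsonConst d L B 0 := by
  have h := linkLap_finset_sum B Finset.univ (fun e : Edge d L => anchTerm B 0 e)
    fun e _ => contDiff_anchTerm B 0 e
  have hS : ∑ e : Edge d L, anchorS e (WilsonFlow.coeConfig U) =
      ambWilsonAction (WilsonFlow.coeConfig U) :=
    (congrFun (ambWilsonAction_eq_sum_anchorS (d := d) (L := L) (n := n)) (WilsonFlow.coeConfig U)).symm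
  have hterm : ∀ e : Edge d L, linkLap B (anchTerm B 0 e) (WilsonFlow.coeConfig U) =
      anchorS e (WilsonFlow.coeConfig U) - ∫ U', anchorS e (WilsonFlow.coeConfig U')
        ∂(trivialMeasure (Matrix.specialUnitaryGroup (Fin n) ℂ) d L) :=
    fun e => linkLap_solvePD B (anchorS_mem' e) U
  calc linkLap B (wilsonSk d L B 0) (WilsonFlow.coeConfig U)
      = ∑ e : Edge d L, linkLap B (anchTerm B 0 e) (WilsonFlow.coeConfig U) := by
        show linkLap B (fun W => ∑ e : Edge d L, anchTerm B 0 e W) _ = _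
        rw [h]
    _ = ambWilsonAction (WilsonFlow.coeConfig U) + wilsonConst d L B 0 := by
        rw [Finset.sum_congr rfl fun e _ => hterm e, Finset.sum_sub_distrib, hS]
        simp only [wilsonConst]
        ring

/-- The bilinear term is additive in the anchor: `∑_e ∑_{e',a} ∂S_W ∂G^{(k)}_e = ∑_{e',a} ∂S_W ∂S̃^{(k)}`.
[folklore] -/
theorem sum_wilsonRhs_eq (B : SuBasis n) (k : ℕ) (W : AmbConfig d L n) :
    ∑ e : Edge d L, wilsonRhs B (anchTerm B k e) W =
      ∑ e' : Edge d L, ∑ a : B.ι,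
        linkDeriv e' (B.T a) (ambWilsonAction : AmbConfig d L n → ℝ) W *
          linkDeriv e' (B.T a) (wilsonSk d L B k) W := by
  have hD : ∀ (e' : Edge d L) (a : B.ι), linkDeriv e' (B.T a) (wilsonSk d L B k) W =
      ∑ e : Edge d L, linkDeriv e' (B.T a) (anchTerm B k e) W := fun e' a =>
    congrFun (linkDeriv_finset_sum e' (B.T a) Finset.univ (fun e : Edge d L => anchTerm B k e)
      fun e _ => contDiff_anchTerm B k e) W
  simp only [hD, wilsonRhs, Finset.mul_sum]
  rw [Finset.sum_comm]
  exact Finset.sum_congr rfl fun e' _ => Finset.sum_comm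

/-- Order `k+1` of the recursion: `Δ S̃^{(k+1)} = -∑_{e,a} ∂^a_e S_W · ∂^a_e S̃^{(k)} + Ċ^{(k+1)}` on
`SU(n)^E`. [cite: Luscher2010Trivializing, §4.3 eqs. (4.13), (4.15)] -/
theorem linkLap_wilsonSk_succ (B : SuBasis n) (k : ℕ)
    (U : GaugeConfig d L (Matrix.specialUnitaryGroup (Fin n) ℂ)) :
    linkLap B (wilsonSk d L B (k + 1)) (WilsonFlow.coeConfig U) =
      -(∑ e : Edge d L, ∑ a : B.ι,
          linkDeriv e (B.T a) (ambWilsonAction : AmbConfig d L n → ℝ) (WilsonFlow.coeConfig U) *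
            linkDeriv e (B.T a) (wilsonSk d L B k) (WilsonFlow.coeConfig U)) + wilsonConst d L B (k + 1) := by
  have h := linkLap_finset_sum B Finset.univ (fun e : Edge d L => anchTerm B (k + 1) e)
    fun e _ => contDiff_anchTerm B (k + 1) e
  have hterm : ∀ e : Edge d L, linkLap B (anchTerm B (k + 1) e) (WilsonFlow.coeConfig U) =
      -wilsonRhs B (anchTerm B k e) (WilsonFlow.coeConfig U) +
        ∫ U', wilsonRhs B (anchTerm B k e) (WilsonFlow.coeConfig U')
          ∂(trivialMeasure (Matrix.specialUnitaryGroup (Fin n) ℂ) d L) := by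
    intro e
    rw [anchTerm_succ, linkLap_solvePD]
    simp only [Pi.neg_apply, integral_neg, sub_neg_eq_add]
  rw [← sum_wilsonRhs_eq]
  calc linkLap B (wilsonSk d L B (k + 1)) (WilsonFlow.coeConfig U)
      = ∑ e : Edge d L, linkLap B (anchTerm B (k + 1) e) (WilsonFlow.coeConfig U) := by
        show linkLap B (fun W => ∑ e : Edge d L, anchTerm B (k + 1) e W) _ = _
        rw [h]
    _ = -(∑ e : Edge d L, wilsonRhs B (anchTerm B k e) (WilsonFlow.coeConfig U)) + wilsonConst d L B (k + 1) := by
        rw [Finset.sum_congr rfl fun e _ => hterm e, Finset.sum_add_distrib, Finset.sum_neg_distrib]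
        simp only [wilsonConst]

/-- **The anchored recursion solves Lüscher's recursion** (4.12)–(4.15) for the Wilson action, with the
constants `wilsonConst`. [cite: Luscher2010Trivializing, §4.3 eqs. (4.12)–(4.15)] -/
theorem isLuscherSeries_wilsonSk (B : SuBasis n) :
    IsLuscherSeries B ambWilsonAction (wilsonSk d L B) (wilsonConst d L B) :=
  ⟨fun U => linkLap_wilsonSk_zero B U, fun k U => linkLap_wilsonSk_succ B k U⟩

/-- **Linear footprint growth**: `S̃^{(k)} = ∑_e G^{(k)}_e` is a local sum of range `1 + k`.
[cite: Luscher2010Trivializing, §4.5(a)] -/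
theorem isLocalSum_wilsonSk (B : SuBasis n) (k : ℕ) : IsLocalSum (1 + k) (wilsonSk d L B k) :=
  ⟨fun e => anchTerm B k e, fun e => by rw [Nat.add_comm 1 k]; exact dependsOn_anchTerm B k e, rfl⟩

end Series

section Main

variable (d L n : ℕ)

/-- **`LuscherFootprintLinear` holds** (venture target, file `Truncation` §4): for every `d`, `L ≥ 1`, `n`
and every orthonormal basis of `𝔰𝔲(n)` there is a smooth Lüscher series of the Wilson action whose
order-`k` term is a local sum of range `1 + k`. [cite: Luscher2010Trivializing, §4.3–§4.5(a)] -/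
theorem luscherFootprintLinear_holds : LuscherFootprintLinear d L n := by
  intro _ B
  exact ⟨wilsonSk d L B, wilsonConst d L B, isLuscherSeries_wilsonSk B, fun k => contDiff_wilsonSk B k,
    fun k => isLocalSum_wilsonSk B k⟩

/-- **Existence of a smooth, local Lüscher series for the Wilson action** on every finite periodic
lattice (the hypothesis `IsLuscherSeries B ambWilsonAction Sk c ∧ ∀ k, ContDiff ℝ ∞ (Sk k)` of the
files `Truncation`, `TruncatedMapLogWeight`, `UniformRadius` is never vacuous).
[cite: Luscher2010Trivializing, §4.3–§4.4] -/
theorem exists_isLuscherSeries_wilson [NeZero L] (B : SuBasis n) :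
    ∃ (Sk : ℕ → AmbConfig d L n → ℝ) (c : ℕ → ℝ),
      IsLuscherSeries B ambWilsonAction Sk c ∧ (∀ k, ContDiff ℝ ∞ (Sk k)) ∧
        ∀ k, IsLocalSum (1 + k) (Sk k) :=
  luscherFootprintLinear_holds d L n B

end Main

end

end Summit.Ventures.LatticeQCDFlow.TrivializingMaps
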